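import Literature.Barriers.HodgeConjecture.DecompositionOfTheDiagonal

/-!
# Route CurveNetMordellWeil — objects the route posits (definitions): the regime split of the middle step

Definitions used by the `--supports` files of the crux `VerticalSupportMiddle`
(stmt-HodgeConjecture-2782) on the line `regime-split-middle-step` (crux workfile
`Cruxes/VerticalSupportMiddle/Lines/regime_split_middle_step.lean`, strategist 2026-08-17):

* `RegimeSplit.HodgeBelowDim N` — the Hodge conjecture for all smooth projective complex varieties of
  dimension `< N` (the dimension-induction hypothesis handed to the middle step at `N = 2q`);
* `RegimeSplit.ChowZeroDegenerate X` — `CH₀(X)` is degenerate: every `0`-cycle of `X` is rationally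
  equivalent ON `X` to one supported on some proper Zariski-closed `W ⊊ X` (the hypothesis of the
  Bloch–Srinivas decomposition of the diagonal, Voisin II Cor. 10.21; literally
  `∃ W ≠ univ, Literature.Barriers.HodgeConjecture.ChowZeroSupportedOn X W`, `chowZeroDegenerate_iff`);
* `RegimeSplit.MiddleStepFor P` — the middle-dimensional step of the Hodge conjecture at level `q ≥ 2`
  on the class of `2q`-folds singled out by `P`: `HodgeBelowDim (2q)` ⟹ rational `(q,q)`-classes are
  algebraic on every smooth projective `2q`-fold `X` with `P X`;
* the two regimes are written `MiddleStepFor ChowZeroDegenerate` (the provable regime, Voisin II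
  Prop. 10.26 in every even dimension) and `MiddleStepFor (fun X ↦ ¬ ChowZeroDegenerate X)` (the
  heart: the CH₀-non-degenerate `2q`-folds ⊇ `h^{2q,0} ≠ 0`, Mumford–Roitman, Voisin II Thm. 10.17);
  no parameterless abbreviation is introduced for them (they are statements of this route, not
  results of the literature).

These are route-posited STATEMENTS (hypothesis shapes of the line's stubs and of the strategist's
split kit), not results of the literature; the theorems about them (the level-wise reduction
`hodgeConjecture_of_middleStep`, the descent `supportedHodgeClasses_algebraic_of_hodgeBelowDim`, the
glue `verticalSupportMiddle_of_regimes`, and the CH₀-degenerate regime granted a Gysin / cycle-class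
formalism) live in the sibling proof files `CurveNetMordellWeilVerticalSupportMiddleReduction`,
`CurveNetMordellWeilVerticalSupportMiddleChowDegenerate`.

## References

* [VoisinHodgeII2003] C. Voisin, Hodge Theory and Complex Algebraic Geometry II, Cor. 10.21,
  Thm. 10.17, Prop. 10.26.
* [Deligne2000] P. Deligne, The Hodge conjecture (Clay problem description), §1.
* [KerrPearlstein2011] M. Kerr, G. Pearlstein, An exponential history of functions with logarithmic
  growth, §3.1 (reduction to the middle dimension).
-/

noncomputable section

-- `Summit.HodgeConjecture.HodgeConjecture.Theorems` is the mandated namespace (single-problem summit: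
-- Problem = Summit), which `linter.dupNamespace` flags on every declaration; the lakefile turns the
-- linter off tree-wide (weak option), restated here so stand-alone elaboration is warning-free too.
set_option linter.dupNamespace false

namespace Summit.HodgeConjecture.HodgeConjecture.Theorems.RegimeSplit

open Literature.AlgebraicGeometry.Motives Literature.AlgebraicGeometry.HodgeTheory

/-- **The Hodge conjecture for all smooth projective complex varieties of dimension `< N`**: for
every smooth projective `Y` of dimension `n < N` and every `p`, every rational class of Hodge type
`(p,p)` in `H²ᵖ(Y(ℂ); ℂ)` lies in `algebraicClasses Y p`. The dimension-induction hypothesis the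
middle step receives at `N = 2q`. [cite: Deligne2000, §1] -/
def HodgeBelowDim (N : ℕ) : Prop :=
  ∀ ⦃n : ℕ⦄ ⦃Y : SchemeOver ℂ⦄, n < N → IsSmoothProjective n Y →
    ∀ (p : ℕ) (c : complexBetti Y (2 * p)), IsRationalClass c → IsOfHodgeType n Y (2 * p) p p c →
      c ∈ algebraicClasses Y p

/-- **`CH₀(X)` is degenerate**: there is a proper Zariski-closed `W ⊊ X` such that every `0`-cycle
of `X` (tree: `Motives.cyclesOfDim X.left 0`) is rationally equivalent on `X`
(`Motives.IsRationallyEquivalent · · 0`) to a `0`-cycle supported on `W` — the hypothesis of the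
Bloch–Srinivas decomposition of the diagonal, Voisin II Cor. 10.21 ("`j_* : CH₀(X') → CH₀(X)` is
surjective" for a proper closed algebraic `X' ⊊ X`). Holds for uniruled `X` (Conte–Murre); fails
whenever `h^{n,0}(X) ≠ 0` (Mumford–Roitman, Voisin II Thm. 10.17).
[cite: VoisinHodgeII2003, Cor. 10.21 and Thm. 10.17] -/
def ChowZeroDegenerate (X : SchemeOver ℂ) : Prop :=
  ∃ W : Set X.left, IsClosed W ∧ W ≠ Set.univ ∧ ∀ z ∈ cyclesOfDim X.left 0,
    ∃ z' ∈ cyclesOfDim X.left 0, (∀ x, z' x ≠ 0 → x ∈ W) ∧ IsRationallyEquivalent z z' 0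

/-- `ChowZeroDegenerate X ↔ ∃ W ≠ univ, ChowZeroSupportedOn X W` — the barrier catalogue's notion
(`Literature.Barriers.HodgeConjecture.ChowZeroSupportedOn`) with `W` proper.
[cite: VoisinHodgeII2003, Cor. 10.21] -/
theorem chowZeroDegenerate_iff : ∀ X : SchemeOver ℂ, ChowZeroDegenerate X ↔ ∃ W : Set X.left, W ≠ Set.univ ∧ Literature.Barriers.HodgeConjecture.ChowZeroSupportedOn X W := by
  intro X
  unfold ChowZeroDegenerate Literature.Barriers.HodgeConjecture.ChowZeroSupportedOn
  constructor
  · rintro ⟨W, hW, hne, h⟩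
    exact ⟨W, hne, hW, h⟩
  · rintro ⟨W, hne, hW, h⟩
    exact ⟨W, hW, hne, h⟩

/-- **The middle-dimensional step of the Hodge conjecture at level `q`, on the class of `2q`-folds
singled out by `P`**: for `q ≥ 2` and `X` smooth projective of dimension `2q` with `P X`, the Hodge
conjecture in all dimensions `< 2q` (`HodgeBelowDim (2q)`) implies that every rational `(q,q)`-class
in `H^{2q}(X(ℂ); ℂ)` is algebraic. `P := fun _ ↦ True` is the full middle step, to which the Hodge
conjecture reduces level-wise
(`hodgeConjecture_of_middleStep`); `P := ChowZeroDegenerate` is the Bloch–Srinivas regime (Voisin II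
Prop. 10.26 in every even dimension) and `P := fun X ↦ ¬ ChowZeroDegenerate X` the heart.
[cite: KerrPearlstein2011, §3.1] -/
def MiddleStepFor (P : ∀ _ : SchemeOver ℂ, Prop) : Prop :=
  ∀ ⦃q : ℕ⦄ ⦃X : SchemeOver ℂ⦄, 2 ≤ q → IsSmoothProjective (2 * q) X → HodgeBelowDim (2 * q) → P X →
    ∀ c : complexBetti X (2 * q), IsRationalClass c → IsOfHodgeType (2 * q) X (2 * q) q q c →
      c ∈ algebraicClasses X q

end Summit.HodgeConjecture.HodgeConjecture.Theorems.RegimeSplit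

end
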